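import Summits.Langlands.Langlands.Theses.DyadicOddResidue
import HarnessLib

/-!
# Route DyadicOddResidue — `SectorComplement` (stmt-Langlands-18745): transport of the summit
along RIGID reciprocity data (line `Sketch_18745_r1_k1`, idea `reciprocity-rigidity`; `--supports`
file; no definitions)

The 2026-08-16 re-type of the summit reads
`Langlands := ∀ F, Nonempty (ReciprocityData F) ∧ ∀ 𝓡 n>0 hcpt, (A) ∧ (B)`, i.e. the global
correspondence is demanded for ALL pinned reciprocity data `𝓡`, whereas every landed seam of the
sub concludes the `∃ 𝓡` text.  The only `𝓡`-dependence of `(A) ∧ (B)` is the value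
`(𝓡.llc v).recGL n [π_v]` in the local–global clause at the local components `π_v` of cuspidal
`π` (`IsGeometricFramed` and the `v ∣ ℓ` clause read the PINNED datum `ReciprocityData.pst`,
`𝓡`-independent by `rfl`).  Hence, writing R for RIGIDITY — any two pinned reciprocity data agree
on the local components of cuspidal automorphic representations of `GL_n(𝔸_K)`, `n ≥ 1` (spelled
out as a hypothesis below; it is the statement the line reduces to Henniart's uniqueness) —:

* `localGlobalCompatibleAt_transport`, `corresponds_transport`, `globalLanglands_transport`:
  `(A) ∧ (B)` for `𝓡` gives `(A) ∧ (B)` for `𝓡'` when the two data agree on local components;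
* `langlands_iff_exists_of_rigid`: under R, `Langlands ↔ Langlands_∃`
  (`Langlands_∃ := ∀ F, ∃ 𝓡, ∀ n>0 hcpt, (A) ∧ (B)`, spelled out);
* `sectorComplement_of_rigid_of_junction`: under R, the `∃`-form of the junction
  (`X → Langlands_∃`) gives the crux `SectorComplement` BY NAME (conditional: credits nothing);
* `junctionExists_of_sectorComplement`: conversely the crux gives `X → Langlands_∃` outright.

Pure logic over the accepted statement; std axioms.  The same transport serves every frame item of
the sub (`SkinnerWilesDefectOne/EisensteinGelfandKirillov/HolomorphicShadow.SectorComplement`,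
`OddResidueBelowFive.OddSectorToLanglands`, `CapacityClassicality.SectorToLanglands`, …).

The logical position of the junction (`¬C ↔ X ∧ ¬Langlands`, `¬X → ¬Langlands`, truth table) is
already landed by the disprover: `Theorems/SectorComplement/Negative/DyadicOddResidueSectorComplementPosition.lean`
(not restated here).

Reference for R in print: G. Henniart, *Caractérisation de la correspondance de Langlands locale par
les facteurs ε de paires*, Invent. Math. 113 (1993), Thm. 1.1; M. Harris, R. Taylor, AMS 151
(2001), Thm. A ("there is at most one such family of bijections").
-/

noncomputable section

set_option linter.dupNamespace false -- project-wide option; `Summit.Langlands.Langlands` is the mandated namespace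

open scoped MatrixGroups NumberField
open NumberField IsDedekindDomain Filter
open Literature.NumberTheory.Automorphic Literature.NumberTheory.GaloisRepresentations
open Summit.Langlands
open Summit.Langlands.Langlands.Theses.DyadicOddResidue

namespace Summit.Langlands.Langlands.Theorems.ReciprocityRigidity

section Transport

variable {K : Type} [Field K] [NumberField K] {n : ℕ} {hcpt : isCompact_glFiniteIntegralLevel n K}
  {ℓ : ℕ} [Fact ℓ.Prime]

/-- **Transport of local–global compatibility at `v`** along two reciprocity data that agree on
the local components of `π` at `v` (the `p`-adic Hodge datum `ReciprocityData.pst` is pinned,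
hence the same term for both data). [folklore] -/
theorem localGlobalCompatibleAt_transport (𝓡 𝓡' : ReciprocityData K) (ι : PadicAlgCl ℓ ≃+* ℂ)
    (π : CuspidalAutomorphicRepData n K hcpt) (ρ : FramedGaloisRep K (PadicAlgCl ℓ) n)
    (v : HeightOneSpectrum (𝓞 K))
    (h : ∀ πv : SmoothIrrep (GL (Fin n) (v.adicCompletion K)), π.1.HasLocalComponentAt v πv.ρ →
      (𝓡.llc v).recGL n (IrrClass.mk πv) = (𝓡'.llc v).recGL n (IrrClass.mk πv))
    (hL : LocalGlobalCompatibleAt 𝓡 ι π.1 ρ v) : LocalGlobalCompatibleAt 𝓡' ι π.1 ρ v := by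
  obtain ⟨πv, r, rℂ, hπv, hlad, hpst, htr, hcls⟩ := hL
  refine ⟨πv, r, rℂ, hπv, hlad, hpst, htr, ?_⟩
  rw [← h πv hπv]
  exact hcls

/-- **Transport of `Corresponds`** along two data that agree on the local components of `π`.
[folklore] -/
theorem corresponds_transport (𝓡 𝓡' : ReciprocityData K) (ι : PadicAlgCl ℓ ≃+* ℂ)
    (π : CuspidalAutomorphicRepData n K hcpt) (ρ : FramedGaloisRep K (PadicAlgCl ℓ) n)
    (h : ∀ (v : HeightOneSpectrum (𝓞 K)) (πv : SmoothIrrep (GL (Fin n) (v.adicCompletion K))),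
      π.1.HasLocalComponentAt v πv.ρ →
        (𝓡.llc v).recGL n (IrrClass.mk πv) = (𝓡'.llc v).recGL n (IrrClass.mk πv))
    (hc : Corresponds 𝓡 ι π.1 ρ) : Corresponds 𝓡' ι π.1 ρ :=
  ⟨hc.1, fun v ↦ localGlobalCompatibleAt_transport 𝓡 𝓡' ι π ρ v (h v) (hc.2 v)⟩

/-- **Transport of the whole correspondence `(A) ∧ (B)` in rank `n`** along two data that agree
on the local components of every cuspidal `π` of `GL_n(𝔸_K)` (`IsGeometricFramed` reads the
pinned datum only; the uniqueness clause of (A) is transported backwards). [folklore] -/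
theorem globalLanglands_transport (𝓡 𝓡' : ReciprocityData K)
    (h : ∀ (π : CuspidalAutomorphicRepData n K hcpt) (v : HeightOneSpectrum (𝓞 K))
      (πv : SmoothIrrep (GL (Fin n) (v.adicCompletion K))), π.1.HasLocalComponentAt v πv.ρ →
        (𝓡.llc v).recGL n (IrrClass.mk πv) = (𝓡'.llc v).recGL n (IrrClass.mk πv))
    (hG : GlobalLanglandsCorrespondenceGLn n K 𝓡 hcpt) :
    GlobalLanglandsCorrespondenceGLn n K 𝓡' hcpt := by
  obtain ⟨hA, hB⟩ := hG
  refine ⟨fun π hLalg ℓ _ ι ↦ ?_, fun ℓ _ ι ρ hirr hgeo ↦ ?_⟩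
  · obtain ⟨ρ, hirr, hgeo, hcorr, huniq⟩ := hA π hLalg ℓ ι
    exact ⟨ρ, hirr, hgeo, corresponds_transport 𝓡 𝓡' ι π ρ (h π) hcorr,
      fun ρ' hcorr' ↦ huniq ρ' (corresponds_transport 𝓡' 𝓡 ι π ρ'
        (fun v πv hπv ↦ (h π v πv hπv).symm) hcorr')⟩
  · obtain ⟨π, hLalg, hcorr⟩ := hB ℓ ι ρ hirr hgeo
    exact ⟨π, hLalg, corresponds_transport 𝓡 𝓡' ι π ρ (h π) hcorr⟩

end Transport

/-- **Under rigidity, `Langlands ↔ Langlands_∃`**: the re-type `∃ 𝓡 ↦ Nonempty ∧ ∀ 𝓡` of the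
summit costs exactly R.  Hypothesis `hR` = R spelled out: any two pinned reciprocity data agree on
the local components of cuspidal automorphic representations, in every rank `n ≥ 1` (in print:
Henniart 1993, Thm. 1.1, local components being generic). [cite: Henniarts1993, Thm 1.1] -/
theorem langlands_iff_exists_of_rigid
    (hR : ∀ (K : Type) [Field K] [NumberField K] (𝓡 𝓡' : ReciprocityData K) (n : ℕ)
      (hcpt : isCompact_glFiniteIntegralLevel n K), 0 < n →
      ∀ (π : CuspidalAutomorphicRepData n K hcpt) (v : HeightOneSpectrum (𝓞 K))
        (πv : SmoothIrrep (GL (Fin n) (v.adicCompletion K))), π.1.HasLocalComponentAt v πv.ρ →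
          (𝓡.llc v).recGL n (IrrClass.mk πv) = (𝓡'.llc v).recGL n (IrrClass.mk πv)) :
    _root_.Langlands ↔
      ∀ (F : Type) [Field F] [NumberField F], ∃ 𝓡 : ReciprocityData F, ∀ n : ℕ, 0 < n →
        ∀ hcpt : isCompact_glFiniteIntegralLevel n F, GlobalLanglandsCorrespondenceGLn n F 𝓡 hcpt := by
  constructor
  · intro hL F _ _
    obtain ⟨⟨𝓡⟩, hall⟩ := hL F
    exact ⟨𝓡, hall 𝓡⟩
  · intro hE F _ _
    obtain ⟨𝓡, h𝓡⟩ := hE F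
    exact ⟨⟨𝓡⟩, fun 𝓡' n hn hcpt ↦
      globalLanglands_transport 𝓡 𝓡' (hR F 𝓡 𝓡' n hcpt hn) (h𝓡 n hn hcpt)⟩

/-- **TRANSFER for the crux**: R (spelled out) and the `∃`-form of the junction
`X → Langlands_∃` give `SectorComplement` BY NAME.  `(X → Langlands_∃) → SectorComplement` fails
without R (it is exactly the rigidity gap) and `R → SectorComplement` fails without the junction
(R is a local statement), so neither hypothesis restates the crux; the junction `∃`-form is the
open reciprocity conjecture off the sector and is NOT claimed. [folklore] -/
theorem sectorComplement_of_rigid_of_junction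
    (hR : ∀ (K : Type) [Field K] [NumberField K] (𝓡 𝓡' : ReciprocityData K) (n : ℕ)
      (hcpt : isCompact_glFiniteIntegralLevel n K), 0 < n →
      ∀ (π : CuspidalAutomorphicRepData n K hcpt) (v : HeightOneSpectrum (𝓞 K))
        (πv : SmoothIrrep (GL (Fin n) (v.adicCompletion K))), π.1.HasLocalComponentAt v πv.ρ →
          (𝓡.llc v).recGL n (IrrClass.mk πv) = (𝓡'.llc v).recGL n (IrrClass.mk πv))
    (hJ : OddRegularReciprocityQ →
      ∀ (F : Type) [Field F] [NumberField F], ∃ 𝓡 : ReciprocityData F, ∀ n : ℕ, 0 < n →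
        ∀ hcpt : isCompact_glFiniteIntegralLevel n F, GlobalLanglandsCorrespondenceGLn n F 𝓡 hcpt) :
    SectorComplement :=
  fun hX ↦ (langlands_iff_exists_of_rigid hR).2 (hJ hX)

/-- … and the transfer loses nothing: the crux gives the `∃`-form of the junction with NO
hypothesis (direction `→` of `langlands_iff_exists_of_rigid` is free). [folklore] -/
theorem junctionExists_of_sectorComplement (hC : SectorComplement) (hX : OddRegularReciprocityQ) :
    ∀ (F : Type) [Field F] [NumberField F], ∃ 𝓡 : ReciprocityData F, ∀ n : ℕ, 0 < n →
      ∀ hcpt : isCompact_glFiniteIntegralLevel n F, GlobalLanglandsCorrespondenceGLn n F 𝓡 hcpt := by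
  intro F _ _
  obtain ⟨⟨𝓡⟩, hall⟩ := hC hX F
  exact ⟨𝓡, hall 𝓡⟩

end Summit.Langlands.Langlands.Theorems.ReciprocityRigidity

end
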